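import Summits.CriticalPhenomena.SAWScalingLimit.Theorems.BoundaryTP2.Negative.TP2CertKit
import Summits.CriticalPhenomena.SAWScalingLimit.Theorems.LeftRightFKG.Negative.PolyCert
import Summits.CriticalPhenomena.SAWScalingLimit.Theorems.SAWTotalPositivityBoundaryTP2Kernel
import HarnessLib

/-!
# Kernel certificates for the three-point splitting inequality on boxes
# (crux `LeftRightFKG`, stmt-CriticalPhenomena-11232, line `corner-localisation`, skeleton v7, stub `stub_threePoint`)

Lead c2 (prover-line-stmt-CriticalPhenomena-11232-c2-0, 2026-08-17). The open stub `stub_threePoint = ThreePointAt x_c`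
(`…ThreePointDefs`) asserts `Z_H(w,p)·Z_H(w,q) ≤ Z_H(p,q)` at `x_c` for every finite `H ≤ ℤ²`, every vertex `w` with an
isolated lattice neighbour and all `p, q` (`Z_H = BoundaryTP2.pathKernel H x_c`). Its instances on lattice BOXES are
decidable by the tree's certified-compute lane, and this file is the thin ADAPTER that makes each of them one kernel
computation (the human's certificate objective, 2026-08-16: Lean-checkable witnesses shaped for `SAW.weight` rather than
asymptotics):

* `evalR_realOf_map_natCast` — the validated-numerics evaluation `PolyMP.evalR ∘ PolyCert.realOf` of a natural
  coefficient list agrees with the enumerator's `evPoly`;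
* `threePoint_Zx_of_posOn` — for box sites `w, p` (and any `q`) of `{0..a} × {0..b}`: if the sign checker
  `PolyMP.posOn` passes on the interval polynomial of the "minor" `Z(p,q)·1 − Z(w,p)·Z(w,q)` built from the EXACT
  two-point polynomials `pathCount a b · ·` (proved-complete, proved-sound, duplicate-free enumerator `boxPaths`,
  `Cert.Zx_eq_evPoly`) on a window `[lo, hi]`, then `Z_x(w,p)·Z_x(w,q) < Z_x(p,q)` for every real `x ∈ [lo,hi]`, where
  `Z_x = Zx x (rectDomain a b) 1` is the fugacity-`x` two-point sum over the `SAW.DomainSAW`s of the box;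
* `Zx_eq_pathKernel` — `Zx x Ω δ u v = BoundaryTP2.pathKernel (discreteDomainGraph Ω δ) x u v` (the stub's kernel);
* `threePoint_pathKernel_of_posOn` — the same certificate in the stub's own terms, at any `x` in the window; with the
  window `[200/539, 5/13] ∋ x_c` (the tree's computational-grade enclosure `2.6 ≤ μ ≤ 2.695`,
  `CornerCert.criticalFugacity_mem_compWindow`, kept OUT of this file so that it stays axiom-clean) it is an instance
  of `ThreePointAt x_c` for the box graph (whose boundary sites all have isolated outer neighbours).

Instances (data-free: the statement names the box and the three sites; kernel `decide` up to the `4 × 4` box in seconds — `5 × 5` already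
exceeds the default recursion limits — `native_decide` beyond) are for the `ccert` seat; the tightest box triples found by the lead's census are the straight-boundary ones
(`w` a non-corner boundary site between its two boundary neighbours: ratio `1.105–1.107` at `x_c` on `6×6 … 10×8`).
Everything here is proved; no facts, no new definitions. [folklore]
-/

noncomputable section

namespace Summit.CriticalPhenomena.SAWScalingLimit.Theorems.LeftRightFKG.ThreePoint

open Literature.Analysis.ValidatedNumerics Literature.Probability.LatticeModels
  Literature.Probability.RandomPlanarGeometry
open Summit.CriticalPhenomena.SAWScalingLimit.Theorems.EdgeOfPositivity.Negative (Zx rectDomain rectSites)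
open Summit.CriticalPhenomena.SAWScalingLimit.Theorems.BoundaryTP2.Negative.Cert (evPoly evPoly_cons evPoly_nonneg
  pathCount Zx_eq_evPoly)
open Summit.CriticalPhenomena.SAWScalingLimit.Theorems.LeftRightFKG.Negative
open scoped ENNReal

/-! ## The two polynomial evaluations agree -/

/-- The validated-numerics Horner evaluation of the integer image of a natural coefficient list is the enumerator's
`evPoly`. [folklore] -/
theorem evalR_realOf_map_natCast : ∀ (cs : List ℕ) (x : ℝ),
    PolyMP.evalR (PolyCert.realOf (cs.map fun n : ℕ => (n : ℤ))) x = evPoly cs x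
  | [], x => by simp [PolyCert.realOf]
  | c :: cs, x => by
    rw [List.map_cons, PolyCert.realOf_cons, PolyMP.evalR_cons, evPoly_cons, evalR_realOf_map_natCast cs x]
    push_cast
    ring

/-- `realOf [1]` evaluates to `1`. [folklore] -/
theorem evalR_realOf_one (x : ℝ) : PolyMP.evalR (PolyCert.realOf [1]) x = 1 := by
  simp [PolyCert.realOf]

/-! ## The certificate, for the box two-point sums -/

/-- **Three-point certificate on a box, `Zx` form.** For sites `w, p` of the box `{0..a} × {0..b}` and any `q`: a
passing run of `PolyMP.posOn` (scale `S > 0`, depth `d`) on the interval polynomial of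
`Z(p,q)·1 − Z(w,p)·Z(w,q)` assembled from the exact two-point polynomials `pathCount a b` on the window `[lo,hi]`
gives `Z_x(w,p) · Z_x(w,q) < Z_x(p,q)` for every real `x ∈ [lo, hi]` with `0 ≤ lo`. [folklore] -/
theorem threePoint_Zx_of_posOn {a b : ℕ} {w p q : Site 2} (hw : w ∈ rectSites a b) (hp : p ∈ rectSites a b)
    {S d : ℕ} (hS : 0 < S) {lo hi : ℚ}
    (h : PolyMP.posOn S d (PolyCert.minorI S ((pathCount a b p q).map fun n : ℕ => (n : ℤ)) [1]
      ((pathCount a b w p).map fun n : ℕ => (n : ℤ)) ((pathCount a b w q).map fun n : ℕ => (n : ℤ))) lo hi = true)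
    (hle : lo ≤ hi) (hlo0 : 0 ≤ lo) {x : ℝ} (hlo : (lo : ℝ) ≤ x) (hhi : x ≤ (hi : ℝ)) :
    Zx x (rectDomain a b) 1 w p * Zx x (rectDomain a b) 1 w q < Zx x (rectDomain a b) 1 p q := by
  have hx : 0 ≤ x := le_trans (by exact_mod_cast hlo0) hlo
  have hlt := PolyCert.minor_pos_of_posOn hS h hle hlo hhi
  rw [evalR_realOf_map_natCast, evalR_realOf_map_natCast, evalR_realOf_map_natCast, evalR_realOf_one,
    mul_one] at hlt
  rw [Zx_eq_evPoly hw hx, Zx_eq_evPoly hw hx, Zx_eq_evPoly hp hx,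
    ← ENNReal.ofReal_mul (evPoly_nonneg _ hx)]
  exact (ENNReal.ofReal_lt_ofReal_iff (lt_of_le_of_lt (mul_nonneg (evPoly_nonneg _ hx) (evPoly_nonneg _ hx))
    hlt)).2 hlt

/-! ## The same in the stub's terms: the path kernel of the box graph -/

/-- The box two-point sum is the self-avoiding path kernel of the domain graph (same paths, same weights). [folklore] -/
theorem Zx_eq_pathKernel (x : ℝ) (Ω : Set ℂ) (δ : ℝ) (u v : Site 2) :
    Zx x Ω δ u v = BoundaryTP2.pathKernel (discreteDomainGraph Ω δ) x u v := by
  rw [Zx, BoundaryTP2.pathKernel]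
  exact Equiv.tsum_eq (BoundaryTP2.domainSAWEquivPath Ω δ u v)
    (fun γ : (discreteDomainGraph Ω δ).Path u v => ENNReal.ofReal (x ^ γ.1.length))

/-- **Three-point certificate on a box, kernel form** (the shape of `ThreePointAt x` on the box graph
`discreteDomainGraph (rectDomain a b) 1`): under the hypotheses of `threePoint_Zx_of_posOn`,
`Z(w,p) · Z(w,q) < Z(p,q)` for `Z = BoundaryTP2.pathKernel (discreteDomainGraph (rectDomain a b) 1) x` and every real
`x ∈ [lo, hi]`. With `lo = 200/539`, `hi = 5/13` and `CornerCert.criticalFugacity_mem_compWindow` this is the instance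
at `x_c`. [folklore] -/
theorem threePoint_pathKernel_of_posOn {a b : ℕ} {w p q : Site 2} (hw : w ∈ rectSites a b)
    (hp : p ∈ rectSites a b) {S d : ℕ} (hS : 0 < S) {lo hi : ℚ}
    (h : PolyMP.posOn S d (PolyCert.minorI S ((pathCount a b p q).map fun n : ℕ => (n : ℤ)) [1]
      ((pathCount a b w p).map fun n : ℕ => (n : ℤ)) ((pathCount a b w q).map fun n : ℕ => (n : ℤ))) lo hi = true)
    (hle : lo ≤ hi) (hlo0 : 0 ≤ lo) {x : ℝ} (hlo : (lo : ℝ) ≤ x) (hhi : x ≤ (hi : ℝ)) :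
    BoundaryTP2.pathKernel (discreteDomainGraph (rectDomain a b) 1) x w p *
        BoundaryTP2.pathKernel (discreteDomainGraph (rectDomain a b) 1) x w q <
      BoundaryTP2.pathKernel (discreteDomainGraph (rectDomain a b) 1) x p q := by
  simpa only [Zx_eq_pathKernel] using threePoint_Zx_of_posOn hw hp hS h hle hlo0 hlo hhi

/-! ## A `decide`-sized instance: the `4 × 3` box, `w` the middle of the long side -/

/-- INSTANCE (kernel `decide`; data-free): on the box `{0..3} × {0..2}` (12 sites), with `w = (1,0)` on the bottom
side and `p = (0,0)`, `q = (2,0)` its two boundary neighbours, the three-point inequality holds STRICTLY at every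
fugacity of the window `[200/539, 5/13] ∋ x_c`: `Z(w,p)·Z(w,q) < Z(p,q)`. [folklore] -/
theorem box43_threePoint_posOn :
    PolyMP.posOn (2 ^ 128) 6 (PolyCert.minorI (2 ^ 128)
      ((pathCount 3 2 ![0, 0] ![2, 0]).map fun n : ℕ => (n : ℤ)) [1]
      ((pathCount 3 2 ![1, 0] ![0, 0]).map fun n : ℕ => (n : ℤ))
      ((pathCount 3 2 ![1, 0] ![2, 0]).map fun n : ℕ => (n : ℤ))) (200 / 539) (5 / 13) = true := by
  decide +kernel

/-- The `4 × 3` instance in kernel form: `Z(w,p)·Z(w,q) < Z(p,q)` on the whole window `[200/539, 5/13]`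
(`w = (1,0)`, `p = (0,0)`, `q = (2,0)`, box `{0..3} × {0..2}`). [folklore] -/
theorem box43_threePoint {x : ℝ} (hlo : ((200 / 539 : ℚ) : ℝ) ≤ x) (hhi : x ≤ ((5 / 13 : ℚ) : ℝ)) :
    BoundaryTP2.pathKernel (discreteDomainGraph (rectDomain 3 2) 1) x ![1, 0] ![0, 0] *
        BoundaryTP2.pathKernel (discreteDomainGraph (rectDomain 3 2) 1) x ![1, 0] ![2, 0] <
      BoundaryTP2.pathKernel (discreteDomainGraph (rectDomain 3 2) 1) x ![0, 0] ![2, 0] :=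
  threePoint_pathKernel_of_posOn (by simp) (by simp) (by norm_num) box43_threePoint_posOn (by norm_num)
    (by norm_num) hlo hhi

/-! ## The `4 × 4` box (kernel `decide`) -/

/-- INSTANCE (kernel `decide`): box `{0..3}²`, `w = (1,0)`, `p = (0,0)`, `q = (2,0)` — the bottom-side triple
(ratio `Z(p,q)/(Z(w,p)Z(w,q)) = 1.0955` at `x_c`); strict three-point inequality on the whole window. [folklore] -/
theorem box44_threePoint_posOn :
    PolyMP.posOn (2 ^ 128) 6 (PolyCert.minorI (2 ^ 128)
      ((pathCount 3 3 ![0, 0] ![2, 0]).map fun n : ℕ => (n : ℤ)) [1]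
      ((pathCount 3 3 ![1, 0] ![0, 0]).map fun n : ℕ => (n : ℤ))
      ((pathCount 3 3 ![1, 0] ![2, 0]).map fun n : ℕ => (n : ℤ))) (200 / 539) (5 / 13) = true := by
  decide +kernel

/-- The `4 × 4` instance in kernel form. [folklore] -/
theorem box44_threePoint {x : ℝ} (hlo : ((200 / 539 : ℚ) : ℝ) ≤ x) (hhi : x ≤ ((5 / 13 : ℚ) : ℝ)) :
    BoundaryTP2.pathKernel (discreteDomainGraph (rectDomain 3 3) 1) x ![1, 0] ![0, 0] *
        BoundaryTP2.pathKernel (discreteDomainGraph (rectDomain 3 3) 1) x ![1, 0] ![2, 0] <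
      BoundaryTP2.pathKernel (discreteDomainGraph (rectDomain 3 3) 1) x ![0, 0] ![2, 0] :=
  threePoint_pathKernel_of_posOn (by simp) (by simp) (by norm_num) box44_threePoint_posOn (by norm_num)
    (by norm_num) hlo hhi

/-- REGISTERED STUB `stub_threePointBoxCert` of line `corner-localisation` (lead c2): the box certificate adapter
`threePoint_pathKernel_of_posOn` in closed form (every instance of the open stub `stub_threePoint` on a box is one kernel
computation). [folklore] -/
theorem stub_threePointBoxCert : ∀ (a b : ℕ) (w p q : Site 2), w ∈ rectSites a b → p ∈ rectSites a b → ∀ (S d : ℕ), 0 < S → ∀ (lo hi : ℚ), PolyMP.posOn S d (PolyCert.minorI S ((pathCount a b p q).map fun n : ℕ => (n : ℤ)) [1] ((pathCount a b w p).map fun n : ℕ => (n : ℤ)) ((pathCount a b w q).map fun n : ℕ => (n : ℤ))) lo hi = true → lo ≤ hi → 0 ≤ lo → ∀ x : ℝ, (lo : ℝ) ≤ x → x ≤ (hi : ℝ) → BoundaryTP2.pathKernel (discreteDomainGraph (rectDomain a b) 1) x w p * BoundaryTP2.pathKernel (discreteDomainGraph (rectDomain a b) 1) x w q < BoundaryTP2.pathKernel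 (discreteDomainGraph (rectDomain a b) 1) x p q :=
  fun _ _ _ _ _ hw hp _ _ hS _ _ h hle hlo0 _ hlo hhi => threePoint_pathKernel_of_posOn hw hp hS h hle hlo0 hlo hhi

end Summit.CriticalPhenomena.SAWScalingLimit.Theorems.LeftRightFKG.ThreePoint

end
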